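import Summits.AtomisticToContinuum.HydrodynamicLimit.Theorems.TwoClocksEquilibriumFastWindowLDBirthT12GainRadialGrowth
import Summits.AtomisticToContinuum.HydrodynamicLimit.Theorems.TwoClocksEquilibriumFastWindowLDBirthT12GainDipole
import HarnessLib

/-!
# The TRUE one-step gain term on a GENERAL test function, I: the exact `(τ, x, φ)`-representation
# (Carleman slice with azimuth; helper `t12_gainTerm_true_slice` of the line `birth`, crux
# `TwoClocks.EquilibriumFastWindowLD`, stmt-AtomisticToContinuum-14440; §6 of the corrector-growth plan via
# SLICES, step (1), towards the registered analytic sub-goal `t12_logLinearPreimage_and_dipoleModulus`)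

The radial (`…T12GainRadialGeneral`, `…T12GainRadialGrowth`) and dipole (`…T12GainDipole`) slice files reduce
the true gain term `gainTerm u v = ∫ dM(w) ∫ ((v-w)·ω)₊ u(v') dσ + ∫ dM(w) ∫ ((v-w)·ω)₊ u(w') dσ` on the classes
`G ∘ ‖·‖` and `⟪a, ·⟫ Θ(‖·‖)` to one-dimensional Gaussian averages of a slice functional. This file does the
same for a GENERAL measurable `u : ℝ³ → ℝ` of Gaussian growth `|u x| ≤ C e^{‖x‖²/4}` (the maximal growth of the
tree's pointwise theory of `L`, `kernelAction_eq_pieces_of_gaussGrowth`), keeping the azimuth: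

* **Exchange symmetry** (`gainFst_eq_gainSnd`, `…T12LorentzAngular`): `gainTerm u v = 2 ∫ dM(w) ∫ ((v-w)·ω)₊ u(v') dσ`
  — follow the OWN particle `v' = v - ((v - w)·ω) ω`.
* **Carleman's slice** (`hardSphereKernel_mul_apply_collide_fst`): with `p = ⟪v, ω⟫`, `τ = ⟪w, ω⟫`,
  `((v - w)·ω)₊ u(v') = (p - τ)₊ u(v - (p - τ) ω)` — given the impact direction, the own outgoing VELOCITY (not
  only its speed) sees the Maxwellian partner through the projection `τ = ⟪w, ω⟫` alone, and `τ ∼ γ = N(0, 1)`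
  under `M = stdGaussian` for every `ω` (`stdGaussian_map_inner_sphere`). Domination
  `|(p - τ)₊ u(v - (p - τ)ω)| ≤ C(1 + ‖v‖)e^{‖v‖²/4} · (1 + |τ|)e^{τ²/4}` (`abs_trueSlice_integrand_le`,
  `‖v - (p - τ)ω‖² = ‖v‖² - p² + τ²`) makes both Fubini swaps legitimate (`integrable_gainFst_prod_gauss` on
  `M ⊗ σ`, `integrable_trueSlice_prod_gauss` on `σ ⊗ γ`).
* **Cylindrical coordinates** about the current direction (`t12_integral_sphere_cyl`, `…T12SphereCyl`): for
  `v = S n`, `n` unit, `ω = x n + √(1-x²)(cos φ e₁ n + sin φ e₂ n)` with `dσ = dx dφ` and `p = S x`.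

Whence (`gainTerm_true_eq_slice`, registered **`t12_gainTerm_true_slice`**): for every real `S` and unit `n`,

  `gainTerm u (S n) = 2 ∫ γ(dτ) ∫_{-1}^{1} (S x - τ)₊ ∫_{-π}^{π} u( S n - (S x - τ)·ω(x, φ) ) dφ dx`,

`ω(x, φ) = x n + √(1-x²)(cos φ e₁ n + sin φ e₂ n)`. The Lorentz operator is the slice `τ = 0`
(`lorentzGain_true_eq_slice_zero`), the slice is `γ`-integrable (`integrable_trueSlice_gauss`) and
`gainTerm u - lorentzGain u = 2 ∫ γ(dτ) (J_u(τ) - J_u(0))` (`gainTerm_sub_lorentzGain_true_eq`). The sibling file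
`…T12TrueSliceB` identifies the inner `φ`-integral with the CIRCLE integral of `u` on the sphere of radius
`r(x, τ) = √(S² - (S x)² + τ²)` at cosine `ρ(x, τ) = (S - (S x - τ) x)/r` about `n`: the true collision step is an
average over `(τ, x)` of circle averages of `u` at ONE radius, exactly as the Lorentz step of FACT F
(`t12_lorentzGain_circleAvg`, the case `τ = 0`, `r = S√(1-x²)`, `ρ = √(1-x²)`).

[folklore] (Carleman 1933 / Hilbert 1912 representation of the hard-sphere gain term; Grad 1963 §4;
Cercignani–Illner–Pulvirenti 1994 §3.1, §7.2; step (1) of §6 of the corrector-growth plan of the line `birth`).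
-/

noncomputable section

open MeasureTheory ProbabilityTheory Real Set Filter Metric
open scoped ENNReal BigOperators InnerProductSpace
namespace Summit.AtomisticToContinuum.HydrodynamicLimit.Theorems.ClampedCorrectorBirth

open Literature.Analysis.FluidPDE Literature.MathematicalPhysics.KineticTheory
open Literature.Analysis.UnboundedOperators Literature.Probability.Distributions

variable {u : EuclideanSpace ℝ (Fin 3) → ℝ} {C : ℝ} {n : EuclideanSpace ℝ (Fin 3)}

/-! ### Carleman's slice of the own particle for a general test function -/

/-- **Carleman's slice of the own particle, general test function**: with `p = ⟪v, ω⟫`, `τ = ⟪w, ω⟫`,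
`((v - w)·ω)₊ u(v') = (p - τ)₊ u(v - (p - τ) ω)` — given the impact direction `ω`, the own outgoing velocity
`v' = v - ((v - w)·ω) ω` sees the partner only through its projection `τ` on `ω`. [folklore] -/
theorem hardSphereKernel_mul_apply_collide_fst (u : EuclideanSpace ℝ (Fin 3) → ℝ) (v w : EuclideanSpace ℝ (Fin 3))
    (ω : sphere (0 : EuclideanSpace ℝ (Fin 3)) 1) :
    hardSphereKernel (v, w) ω * u (collide ω (v, w)).1 =
      max (⟪v, (ω : EuclideanSpace ℝ (Fin 3))⟫_ℝ - ⟪w, (ω : EuclideanSpace ℝ (Fin 3))⟫_ℝ) 0 *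
        u (v - (⟪v, (ω : EuclideanSpace ℝ (Fin 3))⟫_ℝ - ⟪w, (ω : EuclideanSpace ℝ (Fin 3))⟫_ℝ) •
          (ω : EuclideanSpace ℝ (Fin 3))) := by
  simp only [hardSphereKernel, collide, inner_sub_left]

/-- Gaussian growth `|u x| ≤ C e^{‖x‖²/4}` on `ℝ³` forces `0 ≤ C`. [folklore] -/
theorem nonneg_of_gaussGrowth_euclidean (hC : ∀ x : EuclideanSpace ℝ (Fin 3), |u x| ≤ C * Real.exp (‖x‖ ^ 2 / 4)) :
    0 ≤ C := by
  have h := hC 0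
  rw [norm_zero] at h
  norm_num at h
  exact (abs_nonneg _).trans h

/-- **The slice integrand is dominated** under Gaussian growth: for `ω ∈ S²` and every real `τ`,
`|(⟪v, ω⟫ - τ)₊ u(v - (⟪v, ω⟫ - τ) ω)| ≤ C (1 + ‖v‖) e^{‖v‖²/4} · (1 + |τ|) e^{τ²/4}`
(`(p - τ)₊ ≤ (1 + ‖v‖)(1 + |τ|)`, `‖v - (p - τ)ω‖² = ‖v‖² - p² + τ² ≤ ‖v‖² + τ²`). [folklore] -/
theorem abs_trueSlice_integrand_le (hC : ∀ x : EuclideanSpace ℝ (Fin 3), |u x| ≤ C * Real.exp (‖x‖ ^ 2 / 4))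
    (v : EuclideanSpace ℝ (Fin 3)) (ω : sphere (0 : EuclideanSpace ℝ (Fin 3)) 1) (τ : ℝ) :
    |max (⟪v, (ω : EuclideanSpace ℝ (Fin 3))⟫_ℝ - τ) 0 *
        u (v - (⟪v, (ω : EuclideanSpace ℝ (Fin 3))⟫_ℝ - τ) • (ω : EuclideanSpace ℝ (Fin 3)))| ≤
      C * (1 + ‖v‖) * Real.exp (‖v‖ ^ 2 / 4) * ((1 + |τ|) * Real.exp (τ ^ 2 / 4)) := by
  have hC0 := nonneg_of_gaussGrowth_euclidean hC
  have ha : |⟪v, (ω : EuclideanSpace ℝ (Fin 3))⟫_ℝ| ≤ ‖v‖ := by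
    have h := abs_real_inner_le_norm v (ω : EuclideanSpace ℝ (Fin 3))
    rwa [norm_eq_of_mem_sphere, mul_one] at h
  have h1 : max (⟪v, (ω : EuclideanSpace ℝ (Fin 3))⟫_ℝ - τ) 0 ≤ (1 + ‖v‖) * (1 + |τ|) :=
    max_le (by nlinarith [le_abs_self ⟪v, (ω : EuclideanSpace ℝ (Fin 3))⟫_ℝ, neg_abs_le τ,
      mul_nonneg (norm_nonneg v) (abs_nonneg τ)]) (by positivity)
  have harg : 0 ≤ ‖v‖ ^ 2 - ⟪v, (ω : EuclideanSpace ℝ (Fin 3))⟫_ℝ ^ 2 + τ ^ 2 := by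
    nlinarith [abs_nonneg ⟪v, (ω : EuclideanSpace ℝ (Fin 3))⟫_ℝ, sq_abs ⟪v, (ω : EuclideanSpace ℝ (Fin 3))⟫_ℝ,
      norm_nonneg v, sq_nonneg τ]
  have hsq : ‖v - (⟪v, (ω : EuclideanSpace ℝ (Fin 3))⟫_ℝ - τ) • (ω : EuclideanSpace ℝ (Fin 3))‖ ^ 2 =
      ‖v‖ ^ 2 - ⟪v, (ω : EuclideanSpace ℝ (Fin 3))⟫_ℝ ^ 2 + τ ^ 2 := by
    rw [norm_sub_smul_sphere, Real.sq_sqrt harg]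
  have h2 : |u (v - (⟪v, (ω : EuclideanSpace ℝ (Fin 3))⟫_ℝ - τ) • (ω : EuclideanSpace ℝ (Fin 3)))| ≤
      C * (Real.exp (‖v‖ ^ 2 / 4) * Real.exp (τ ^ 2 / 4)) := by
    refine (hC _).trans (mul_le_mul_of_nonneg_left ?_ hC0)
    rw [hsq, ← Real.exp_add]
    exact Real.exp_le_exp.2 (by nlinarith [sq_nonneg ⟪v, (ω : EuclideanSpace ℝ (Fin 3))⟫_ℝ])
  rw [abs_mul, abs_of_nonneg (le_max_right _ _)]
  calc max (⟪v, (ω : EuclideanSpace ℝ (Fin 3))⟫_ℝ - τ) 0 *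
        |u (v - (⟪v, (ω : EuclideanSpace ℝ (Fin 3))⟫_ℝ - τ) • (ω : EuclideanSpace ℝ (Fin 3)))|
      ≤ ((1 + ‖v‖) * (1 + |τ|)) * (C * (Real.exp (‖v‖ ^ 2 / 4) * Real.exp (τ ^ 2 / 4))) :=
        mul_le_mul h1 h2 (abs_nonneg _) (by positivity)
    _ = C * (1 + ‖v‖) * Real.exp (‖v‖ ^ 2 / 4) * ((1 + |τ|) * Real.exp (τ ^ 2 / 4)) := by ring

/-! ### Integrability on the two product spaces -/

/-- **Integrability of the own-particle integrand on `M ⊗ σ`** under Gaussian growth: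
`(w, ω) ↦ ((v - w)·ω)₊ u(v')` is dominated by `C (1 + ‖v‖) e^{‖v‖²/4} · (1 + ‖w‖) e^{‖w‖²/4}` (`|⟪w, ω⟫| ≤ ‖w‖`),
integrable against the Maxwellian (`integrable_one_add_norm_mul_exp_sq_div_four_stdGaussian`). [folklore] -/
theorem integrable_gainFst_prod_gauss (hu : Measurable u)
    (hC : ∀ x : EuclideanSpace ℝ (Fin 3), |u x| ≤ C * Real.exp (‖x‖ ^ 2 / 4)) (v : EuclideanSpace ℝ (Fin 3)) :
    Integrable (Function.uncurry fun (w : EuclideanSpace ℝ (Fin 3)) (ω : sphere (0 : EuclideanSpace ℝ (Fin 3)) 1) =>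
        hardSphereKernel (v, w) ω * u (collide ω (v, w)).1)
      ((stdGaussian (EuclideanSpace ℝ (Fin 3))).prod (sphereMeasure : Measure (sphere (0 : EuclideanSpace ℝ (Fin 3)) 1))) := by
  haveI := isFiniteMeasure_sphereMeasure (E := EuclideanSpace ℝ (Fin 3))
  have hC0 := nonneg_of_gaussGrowth_euclidean hC
  have hφ : Integrable (fun w : EuclideanSpace ℝ (Fin 3) =>
      C * (1 + ‖v‖) * Real.exp (‖v‖ ^ 2 / 4) * ((1 + ‖w‖) * Real.exp (‖w‖ ^ 2 / 4)))
      (stdGaussian (EuclideanSpace ℝ (Fin 3))) :=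
    (integrable_one_add_norm_mul_exp_sq_div_four_stdGaussian (E := EuclideanSpace ℝ (Fin 3))).const_mul _
  have hB : Continuous fun p : EuclideanSpace ℝ (Fin 3) × sphere (0 : EuclideanSpace ℝ (Fin 3)) 1 =>
      hardSphereKernel (v, p.1) p.2 := by
    unfold hardSphereKernel; fun_prop
  have hP : Continuous fun p : EuclideanSpace ℝ (Fin 3) × sphere (0 : EuclideanSpace ℝ (Fin 3)) 1 =>
      (collide p.2 (v, p.1)).1 := by
    unfold collide; fun_prop
  refine (hφ.mul_prod (integrable_const (1:ℝ))).mono'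
    (hB.measurable.mul (hu.comp hP.measurable)).aestronglyMeasurable (Eventually.of_forall fun p => ?_)
  rcases p with ⟨w, ω⟩
  simp only [Function.uncurry_apply_pair, mul_one, Real.norm_eq_abs]
  have ht : |⟪w, (ω : EuclideanSpace ℝ (Fin 3))⟫_ℝ| ≤ ‖w‖ := by
    have h := abs_real_inner_le_norm w (ω : EuclideanSpace ℝ (Fin 3))
    rwa [norm_eq_of_mem_sphere, mul_one] at h
  have ht2 : ⟪w, (ω : EuclideanSpace ℝ (Fin 3))⟫_ℝ ^ 2 ≤ ‖w‖ ^ 2 := by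
    rw [← sq_abs]; exact pow_le_pow_left₀ (abs_nonneg _) ht 2
  rw [hardSphereKernel_mul_apply_collide_fst]
  refine (abs_trueSlice_integrand_le hC v ω _).trans ?_
  gcongr

/-- **Integrability of the slice integrand on `σ ⊗ γ`** under Gaussian growth:
`(ω, τ) ↦ (⟪v, ω⟫ - τ)₊ u(v - (⟪v, ω⟫ - τ) ω)` is dominated by `C (1 + ‖v‖) e^{‖v‖²/4} · (1 + |τ|) e^{τ²/4}`,
and `(1 + |τ|) e^{τ²/4} ∈ L¹(γ)` (`integrable_one_add_abs_mul_exp_gaussianReal`). [folklore] -/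
theorem integrable_trueSlice_prod_gauss (hu : Measurable u)
    (hC : ∀ x : EuclideanSpace ℝ (Fin 3), |u x| ≤ C * Real.exp (‖x‖ ^ 2 / 4)) (v : EuclideanSpace ℝ (Fin 3)) :
    Integrable (Function.uncurry fun (ω : sphere (0 : EuclideanSpace ℝ (Fin 3)) 1) (τ : ℝ) =>
        max (⟪v, (ω : EuclideanSpace ℝ (Fin 3))⟫_ℝ - τ) 0 *
          u (v - (⟪v, (ω : EuclideanSpace ℝ (Fin 3))⟫_ℝ - τ) • (ω : EuclideanSpace ℝ (Fin 3))))
      ((sphereMeasure : Measure (sphere (0 : EuclideanSpace ℝ (Fin 3)) 1)).prod (gaussianReal 0 1)) := by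
  haveI := isFiniteMeasure_sphereMeasure (E := EuclideanSpace ℝ (Fin 3))
  have hψ : Integrable (fun τ : ℝ => C * (1 + ‖v‖) * Real.exp (‖v‖ ^ 2 / 4) * ((1 + |τ|) * Real.exp (τ ^ 2 / 4)))
      (gaussianReal 0 1) := integrable_one_add_abs_mul_exp_gaussianReal.const_mul _
  have hmeas : Measurable (Function.uncurry fun (ω : sphere (0 : EuclideanSpace ℝ (Fin 3)) 1) (τ : ℝ) =>
      max (⟪v, (ω : EuclideanSpace ℝ (Fin 3))⟫_ℝ - τ) 0 *
        u (v - (⟪v, (ω : EuclideanSpace ℝ (Fin 3))⟫_ℝ - τ) • (ω : EuclideanSpace ℝ (Fin 3)))) := by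
    refine Measurable.mul (by fun_prop) (hu.comp ?_)
    fun_prop
  refine ((integrable_const (1:ℝ)).mul_prod hψ).mono' hmeas.aestronglyMeasurable (Eventually.of_forall fun p => ?_)
  rcases p with ⟨ω, τ⟩
  simp only [Function.uncurry_apply_pair, one_mul, Real.norm_eq_abs]
  exact abs_trueSlice_integrand_le hC v ω τ

/-! ### The own piece: Gaussian projection and cylindrical coordinates -/

/-- **The own piece as a Gaussian average of sphere slices**: for `u` measurable of Gaussian growth,
`∫ dM(w) ∫_{S²} ((v - w)·ω)₊ u(v') dσ(ω) = ∫ γ(dτ) ∫_{S²} (⟪v, ω⟫ - τ)₊ u(v - (⟪v, ω⟫ - τ) ω) dσ(ω)`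
(Fubini on `M ⊗ σ`, the Gaussian projection `τ = ⟪w, ω⟫ ∼ γ` for every `ω`, Fubini on `σ ⊗ γ`). [folklore] -/
theorem gainFst_eq_integral_trueSlice (hu : Measurable u)
    (hC : ∀ x : EuclideanSpace ℝ (Fin 3), |u x| ≤ C * Real.exp (‖x‖ ^ 2 / 4)) (v : EuclideanSpace ℝ (Fin 3)) :
    ∫ w, ∫ ω, hardSphereKernel (v, w) ω * u (collide ω (v, w)).1 ∂sphereMeasure
        ∂stdGaussian (EuclideanSpace ℝ (Fin 3)) =
      ∫ τ, ∫ ω : sphere (0 : EuclideanSpace ℝ (Fin 3)) 1,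
        max (⟪v, (ω : EuclideanSpace ℝ (Fin 3))⟫_ℝ - τ) 0 *
          u (v - (⟪v, (ω : EuclideanSpace ℝ (Fin 3))⟫_ℝ - τ) • (ω : EuclideanSpace ℝ (Fin 3))) ∂sphereMeasure
        ∂gaussianReal 0 1 := by
  haveI := isFiniteMeasure_sphereMeasure (E := EuclideanSpace ℝ (Fin 3))
  calc ∫ w, ∫ ω, hardSphereKernel (v, w) ω * u (collide ω (v, w)).1 ∂sphereMeasure
          ∂stdGaussian (EuclideanSpace ℝ (Fin 3))
      = ∫ ω, ∫ w, hardSphereKernel (v, w) ω * u (collide ω (v, w)).1 ∂stdGaussian (EuclideanSpace ℝ (Fin 3))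
          ∂sphereMeasure := integral_integral_swap (integrable_gainFst_prod_gauss hu hC v)
    _ = ∫ ω : sphere (0 : EuclideanSpace ℝ (Fin 3)) 1, ∫ τ,
          max (⟪v, (ω : EuclideanSpace ℝ (Fin 3))⟫_ℝ - τ) 0 *
            u (v - (⟪v, (ω : EuclideanSpace ℝ (Fin 3))⟫_ℝ - τ) • (ω : EuclideanSpace ℝ (Fin 3))) ∂gaussianReal 0 1
          ∂sphereMeasure := by
        refine integral_congr_ae (Eventually.of_forall fun ω => ?_)
        dsimp only
        simp_rw [hardSphereKernel_mul_apply_collide_fst]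
        exact integral_stdGaussian_comp_inner_sphere ω
          (h := fun τ => max (⟪v, (ω : EuclideanSpace ℝ (Fin 3))⟫_ℝ - τ) 0 *
            u (v - (⟪v, (ω : EuclideanSpace ℝ (Fin 3))⟫_ℝ - τ) • (ω : EuclideanSpace ℝ (Fin 3)))) (by fun_prop)
    _ = _ := integral_integral_swap (integrable_trueSlice_prod_gauss hu hC v)

/-- **The `τ`-slice on the sphere in cylindrical coordinates**: for unit `n`, real `S, τ` and `u` measurable of
Gaussian growth,
`∫_{S²} (⟪S n, ω⟫ - τ)₊ u(S n - (⟪S n, ω⟫ - τ) ω) dσ(ω) = ∫_{-1}^{1} (S x - τ)₊ ∫_{-π}^{π} u(S n - (S x - τ)(x n + √(1-x²)(cos φ e₁ n + sin φ e₂ n))) dφ dx`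
(`dσ = dx dφ` about `n`, `t12_integral_sphere_cyl`; the flux sees the height `x` only). [folklore] -/
theorem sphereIntegral_trueSlice_eq_cyl (hn : ‖n‖ = 1) (hu : Measurable u)
    (hC : ∀ x : EuclideanSpace ℝ (Fin 3), |u x| ≤ C * Real.exp (‖x‖ ^ 2 / 4)) (S τ : ℝ) :
    ∫ ω : sphere (0 : EuclideanSpace ℝ (Fin 3)) 1,
        max (⟪S • n, (ω : EuclideanSpace ℝ (Fin 3))⟫_ℝ - τ) 0 *
          u (S • n - (⟪S • n, (ω : EuclideanSpace ℝ (Fin 3))⟫_ℝ - τ) • (ω : EuclideanSpace ℝ (Fin 3))) ∂sphereMeasure =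
      ∫ x in (-1:ℝ)..1, max (S * x - τ) 0 * ∫ φ in (-π)..π,
        u (S • n - (S * x - τ) • (x • n + √(1 - x ^ 2) • (cos φ • Lambert.e₁ n + sin φ • Lambert.e₂ n))) := by
  have hk : Measurable fun z : ℝ => max (S * z - τ) 0 := by fun_prop
  have hY : Measurable fun y : EuclideanSpace ℝ (Fin 3) => u (S • n - (S * ⟪n, y⟫_ℝ - τ) • y) :=
    hu.comp (by fun_prop)
  have heq : ∀ ω : sphere (0 : EuclideanSpace ℝ (Fin 3)) 1,
      max (⟪S • n, (ω : EuclideanSpace ℝ (Fin 3))⟫_ℝ - τ) 0 *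
          u (S • n - (⟪S • n, (ω : EuclideanSpace ℝ (Fin 3))⟫_ℝ - τ) • (ω : EuclideanSpace ℝ (Fin 3))) =
        max (S * ⟪n, (ω : EuclideanSpace ℝ (Fin 3))⟫_ℝ - τ) 0 *
          u (S • n - (S * ⟪n, (ω : EuclideanSpace ℝ (Fin 3))⟫_ℝ - τ) • (ω : EuclideanSpace ℝ (Fin 3))) := fun ω => by
    rw [real_inner_smul_left]
  have hi : Integrable (fun ω : sphere (0 : EuclideanSpace ℝ (Fin 3)) 1 =>
      max (S * ⟪n, (ω : EuclideanSpace ℝ (Fin 3))⟫_ℝ - τ) 0 *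
        u (S • n - (S * ⟪n, (ω : EuclideanSpace ℝ (Fin 3))⟫_ℝ - τ) • (ω : EuclideanSpace ℝ (Fin 3)))) sphereMeasure := by
    refine integrable_sphere_of_bound
      ((hk.comp ((measurable_const.inner measurable_id).comp measurable_subtype_coe)).mul (hY.comp measurable_subtype_coe))
      (K := C * (1 + ‖S • n‖) * Real.exp (‖S • n‖ ^ 2 / 4) * ((1 + |τ|) * Real.exp (τ ^ 2 / 4))) fun ω => ?_
    rw [← heq]
    exact abs_trueSlice_integrand_le hC (S • n) ω τ
  simp_rw [heq]
  rw [integral_sphere_zonal_mul_eq_intervalIntegral hn hk hY hi]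
  refine intervalIntegral.integral_congr fun x _ => ?_
  simp_rw [inner_self_cylPoint hn]

/-- **The own piece in `(τ, x, φ)`-form**: for unit `n`, real `S` and `u` measurable of Gaussian growth,
`∫ dM(w) ∫_{S²} ((Sn - w)·ω)₊ u(v') dσ(ω) = ∫ γ(dτ) ∫_{-1}^{1} (S x - τ)₊ ∫_{-π}^{π} u(S n - (S x - τ) ω(x, φ)) dφ dx`,
`ω(x, φ) = x n + √(1-x²)(cos φ e₁ n + sin φ e₂ n)`. [folklore] -/
theorem gainFst_true_eq_slice (hn : ‖n‖ = 1) (hu : Measurable u)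
    (hC : ∀ x : EuclideanSpace ℝ (Fin 3), |u x| ≤ C * Real.exp (‖x‖ ^ 2 / 4)) (S : ℝ) :
    ∫ w, ∫ ω, hardSphereKernel (S • n, w) ω * u (collide ω (S • n, w)).1 ∂sphereMeasure
        ∂stdGaussian (EuclideanSpace ℝ (Fin 3)) =
      ∫ τ, (∫ x in (-1:ℝ)..1, max (S * x - τ) 0 * ∫ φ in (-π)..π,
        u (S • n - (S * x - τ) • (x • n + √(1 - x ^ 2) • (cos φ • Lambert.e₁ n + sin φ • Lambert.e₂ n))))
        ∂gaussianReal 0 1 := by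
  rw [gainFst_eq_integral_trueSlice hu hC (S • n)]
  exact integral_congr_ae (Eventually.of_forall fun τ => sphereIntegral_trueSlice_eq_cyl hn hu hC S τ)

/-- **The true slice is `γ`-integrable**: `τ ↦ ∫_{-1}^{1} (S x - τ)₊ ∫_{-π}^{π} u(S n - (S x - τ) ω(x, φ)) dφ dx ∈ L¹(γ)`
for unit `n`, real `S` and `u` measurable of Gaussian growth. [folklore] -/
theorem integrable_trueSlice_gauss (hn : ‖n‖ = 1) (hu : Measurable u)
    (hC : ∀ x : EuclideanSpace ℝ (Fin 3), |u x| ≤ C * Real.exp (‖x‖ ^ 2 / 4)) (S : ℝ) :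
    Integrable (fun τ => ∫ x in (-1:ℝ)..1, max (S * x - τ) 0 * ∫ φ in (-π)..π,
        u (S • n - (S * x - τ) • (x • n + √(1 - x ^ 2) • (cos φ • Lambert.e₁ n + sin φ • Lambert.e₂ n))))
      (gaussianReal 0 1) := by
  haveI := isFiniteMeasure_sphereMeasure (E := EuclideanSpace ℝ (Fin 3))
  exact ((integrable_trueSlice_prod_gauss hu hC (S • n)).integral_prod_right).congr
    (Eventually.of_forall fun τ => sphereIntegral_trueSlice_eq_cyl hn hu hC S τ)

/-! ### The gain term, the Lorentz slice `τ = 0`, and their difference -/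

/-- **The true gain term on a general test function in `(τ, x, φ)`-form**: for unit `n`, real `S` and `u`
measurable of Gaussian growth,
`gainTerm u (S n) = 2 ∫ γ(dτ) ∫_{-1}^{1} (S x - τ)₊ ∫_{-π}^{π} u(S n - (S x - τ)(x n + √(1-x²)(cos φ e₁ n + sin φ e₂ n))) dφ dx`
(exchange symmetry: twice the own piece). [folklore] -/
theorem gainTerm_true_eq_slice (hn : ‖n‖ = 1) (hu : Measurable u)
    (hC : ∀ x : EuclideanSpace ℝ (Fin 3), |u x| ≤ C * Real.exp (‖x‖ ^ 2 / 4)) (S : ℝ) :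
    gainTerm u (S • n) = 2 * ∫ τ, (∫ x in (-1:ℝ)..1, max (S * x - τ) 0 * ∫ φ in (-π)..π,
        u (S • n - (S * x - τ) • (x • n + √(1 - x ^ 2) • (cos φ • Lambert.e₁ n + sin φ • Lambert.e₂ n))))
        ∂gaussianReal 0 1 := by
  have h2 : ∫ w, ∫ ω, hardSphereKernel (S • n, w) ω * u (collide ω (S • n, w)).2 ∂sphereMeasure
        ∂stdGaussian (EuclideanSpace ℝ (Fin 3)) =
      ∫ w, ∫ ω, hardSphereKernel (S • n, w) ω * u (collide ω (S • n, w)).1 ∂sphereMeasure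
        ∂stdGaussian (EuclideanSpace ℝ (Fin 3)) :=
    integral_congr_ae (Eventually.of_forall fun w => (gainFst_eq_gainSnd (S • n) w hu).symm)
  simp only [gainTerm]
  rw [h2, gainFst_true_eq_slice hn hu hC S]
  ring

/-- **The Lorentz operator is the slice `τ = 0`**: for unit `n`, real `S` and `u` measurable of Gaussian growth,
`lorentzGain u (S n) = 2 ∫_{-1}^{1} (S x)₊ ∫_{-π}^{π} u(S n - S x (x n + √(1-x²)(cos φ e₁ n + sin φ e₂ n))) dφ dx`
(partner at rest: `τ = ⟪0, ω⟫ = 0`; the image point has radius `S√(1-x²)` and cosine `√(1-x²)` about `n` for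
`S, x ≥ 0` — FACT F, `t12_lorentzGain_circleAvg`). [folklore] -/
theorem lorentzGain_true_eq_slice_zero (hn : ‖n‖ = 1) (hu : Measurable u)
    (hC : ∀ x : EuclideanSpace ℝ (Fin 3), |u x| ≤ C * Real.exp (‖x‖ ^ 2 / 4)) (S : ℝ) :
    lorentzGain u (S • n) = 2 * ∫ x in (-1:ℝ)..1, max (S * x) 0 * ∫ φ in (-π)..π,
        u (S • n - (S * x) • (x • n + √(1 - x ^ 2) • (cos φ • Lambert.e₁ n + sin φ • Lambert.e₂ n))) := by
  have h0 := gain_zero_eq_lorentzGain (S • n) hu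
  have h1 := gainFst_eq_gainSnd (S • n) 0 hu
  have h3 : ∫ ω, hardSphereKernel (S • n, 0) ω * u (collide ω (S • n, 0)).1 ∂sphereMeasure =
      ∫ x in (-1:ℝ)..1, max (S * x - 0) 0 * ∫ φ in (-π)..π,
        u (S • n - (S * x - 0) • (x • n + √(1 - x ^ 2) • (cos φ • Lambert.e₁ n + sin φ • Lambert.e₂ n))) := by
    rw [← sphereIntegral_trueSlice_eq_cyl hn hu hC S 0]
    refine integral_congr_ae (Eventually.of_forall fun ω => ?_)
    dsimp only
    rw [hardSphereKernel_mul_apply_collide_fst, inner_zero_left]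
  simp only [sub_zero] at h3
  simp only at h0 h1
  linarith

/-- **The true-minus-Lorentz difference in slice form**: for unit `n`, real `S` and `u` measurable of Gaussian
growth, `gainTerm u (S n) - lorentzGain u (S n) = 2 ∫ γ(dτ) (J_u(τ) - J_u(0))`,
`J_u(τ) = ∫_{-1}^{1} (S x - τ)₊ ∫_{-π}^{π} u(S n - (S x - τ) ω(x, φ)) dφ dx`. [folklore] -/
theorem gainTerm_sub_lorentzGain_true_eq (hn : ‖n‖ = 1) (hu : Measurable u)
    (hC : ∀ x : EuclideanSpace ℝ (Fin 3), |u x| ≤ C * Real.exp (‖x‖ ^ 2 / 4)) (S : ℝ) :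
    gainTerm u (S • n) - lorentzGain u (S • n) =
      2 * ∫ τ, ((∫ x in (-1:ℝ)..1, max (S * x - τ) 0 * ∫ φ in (-π)..π,
          u (S • n - (S * x - τ) • (x • n + √(1 - x ^ 2) • (cos φ • Lambert.e₁ n + sin φ • Lambert.e₂ n)))) -
        ∫ x in (-1:ℝ)..1, max (S * x) 0 * ∫ φ in (-π)..π,
          u (S • n - (S * x) • (x • n + √(1 - x ^ 2) • (cos φ • Lambert.e₁ n + sin φ • Lambert.e₂ n))))
        ∂gaussianReal 0 1 := by
  rw [gainTerm_true_eq_slice hn hu hC S, lorentzGain_true_eq_slice_zero hn hu hC S,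
    integral_sub (integrable_trueSlice_gauss hn hu hC S) (integrable_const _), integral_const, probReal_univ,
    one_smul]
  ring

/-! ### Registered helper -/

/-- **Registered helper `t12_gainTerm_true_slice` — the TRUE one-step gain term on a GENERAL test function
as a `(τ, x)`-average of azimuthal integrals (Carleman slice with azimuth).** For `u : ℝ³ → ℝ` measurable of
Gaussian growth `|u x| ≤ C e^{‖x‖²/4}`, a unit vector `n` and every real `S` (`M = stdGaussian`, `σ` the surface
measure of `S²`, `(v', w') = collide ω (v, w)`, `γ = gaussianReal 0 1`, frame `Lambert.e₁/e₂`):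
`gainTerm u (S n) = ∫ dM(w) ∫ ((Sn-w)·ω)₊ u(v') dσ + ∫ dM(w) ∫ ((Sn-w)·ω)₊ u(w') dσ`
`= 2 ∫ γ(dτ) ∫_{-1}^{1} (S x - τ)₊ ∫_{-π}^{π} u( S n - (S x - τ)(x n + √(1-x²)(cos φ e₁ n + sin φ e₂ n)) ) dφ dx`.
Mechanism: exchange symmetry (`gainFst_eq_gainSnd`: twice the own piece); Carleman's slice — with `p = ⟪v, ω⟫ = S x`,
`τ = ⟪w, ω⟫` the own particle has flux `(p - τ)₊` and outgoing VELOCITY `v - (p - τ) ω`, through `τ` only;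
`τ ∼ γ` under the Maxwellian for every `ω` (`stdGaussian_map_inner_sphere`); cylindrical coordinates `dσ = dx dφ`
about `n` (`t12_integral_sphere_cyl`). The partner enters only via `τ`: the image point `S n - (S x - τ) ω(x, φ)`
runs, as `φ` varies, over the circle of the sphere of radius `r = √(S² - (S x)² + τ²)` at cosine
`ρ = (S - (S x - τ) x)/r` about `n` (sibling `…T12TrueSliceB`), and `τ = 0` is the Lorentz operator
(`lorentzGain_true_eq_slice_zero`; FACT F). [folklore] -/
theorem t12_gainTerm_true_slice : ∀ (u : EuclideanSpace ℝ (Fin 3) → ℝ) (C : ℝ), Measurable u → (∀ x : EuclideanSpace ℝ (Fin 3), |u x| ≤ C * Real.exp (‖x‖ ^ 2 / 4)) → ∀ n : EuclideanSpace ℝ (Fin 3), ‖n‖ = 1 → ∀ S : ℝ, Summit.AtomisticToContinuum.HydrodynamicLimit.Theorems.ClampedCorrectorBirth.gainTerm u (S • n) = 2 * ∫ τ, (∫ x in (-1:ℝ)..1, max (S * x - τ) 0 * ∫ φ in (-Real.pi)..Real.pi, u (S • n - (S * x - τ) • (x • n + Real.sqrt (1 - x ^ 2) • (Real.cos φ •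 Literature.Analysis.FluidPDE.Lambert.e₁ n + Real.sin φ • Literature.Analysis.FluidPDE.Lambert.e₂ n)))) ∂ProbabilityTheory.gaussianReal 0 1 :=
  fun _ _ hu hC _ hn S => gainTerm_true_eq_slice hn hu hC S

end Summit.AtomisticToContinuum.HydrodynamicLimit.Theorems.ClampedCorrectorBirth

end
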